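import Summits.AnomalousDissipation.AnomalousDissipation.Theorems.SolenoidalFractalHomogenisationLagrangianStepW7ThreeModeDefs
import HarnessLib

/-!
# K1L_D (stmt-AnomalousDissipation-27980), registry v8 — W7 ENGINE, THREE-MODE FORM INEQUALITY (abstract real inner-product layer)

Theorems-side landing of planner ad-ideate-p4 g13's kernel-checked crux workfile `Cruxes/LagrangianRenormalisationStep/Lines/onelevel_W7_threemode_vector.lean`
v3 (crux write commit 5e650f09fd83, 0 sorry) — the scalar Young steps and the abstract vector layer (`young_disc`, `threeModeV_scalars_le`,
`norm_proj_le`, `xdotV_expand`, **`threeModeV_form_le`**, `threeModeV_equiv`, `rampV_pairing_le`), statements and proofs VERBATIM; namespace moved to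
`…Theorems.SolenoidalFractalHomogenisation.LagrangianStep.ThreeMode`; the chain definitions `dW0/dWp/dWm/bV/xdotV` are imported from `…W7ThreeModeDefs`.
Landed by the W7 assembly owner (prover ad-sawtooth-k1loc-p1 g11, tenure GO 21:32:19Z); mathematics: p4 g13 (lens «control»), memo `Lines/onelevel-W7-threemode.md` §2.
p4's module docstring, verbatim:


[module docstring:]
# W7 · F-p4g13-1 (vector layer) — the three-mode form inequality for PROJECTED VECTOR modes with ANISOTROPIC damping

Kernel companion of `Lines/onelevel_W7_threemode.lean` §2 (memo `Lines/onelevel-W7-threemode.md` §2, caveat §7 «vector/anisotropic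
Young steps hand + numerics only»): here they are kernel-checked, in an ABSTRACT real inner-product space, so that the W7 prover's step S2
is an instantiation.

Setting (one slot, one Bloch fibre, five consecutive chain modes `0, ±1, ±2`, coupling `ℓ` frozen): vectors `w₀ w₊ w₋ w₊₊ w₋₋ : E`,
"dampings" `y_j` (= `D_j w_j`, any vectors with `d_j‖w_j‖² ≤ ⟪y_j, w_j⟫`, `‖y_±‖ ≤ Dmax‖w_±‖`, `‖y₀‖ ≤ D0‖w₀‖`, `P_± y_± = y_±`),
maps `P₀ P₊ P₋ : E → E` that are self-adjoint and idempotent (orthogonal projections; no linearity is used).  The chain vector field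
(`IsotropicCubatureWord`/`LatticePhase.layer` units, phases gauged away):
`ẇ₀ = −y₀ + ℓ P₀(w₊ − w₋)`, `ẇ₊ = −y₊ − ℓ (P₊ w₀ − P₊ w₊₊)`, `ẇ₋ = −y₋ − ℓ (P₋ w₋₋ − P₋ w₀)`.
Cross term `X = ⟪w₀, b⟫`, `b = ℓ P₀(w₊ − w₋)`; `xdotV` below is `⟪ẇ₀, b⟫ + ⟪w₀, ḃ⟫` with `ℓ` frozen (the ramp `ℓ̇` term is `ramp_term_le`
of the scalar file, it only needs `‖b‖ ≤ ℓ(‖w₊‖+‖w₋‖)`).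

* `young_disc`                 — `c x z ≤ a x² + b z²` from `c² ≤ 4ab`.
* `threeModeV_scalars_le`      — the inequality on the finitely many real quantities (norms, the five inner products), given the
                                  Cauchy–Schwarz bounds: pure real arithmetic, explicit Young squares.
* `xdotV_expand`               — the inner-product expansion of `⟪ẇ₀, b⟫ + ⟪w₀, ḃ⟫` under the projection axioms.
* `threeModeV_form_le`         — THE VECTOR FORM INEQUALITY:
  `−2 Σ_j ⟪y_j, w_j⟫ + ε·xdotV ≤ −(εℓ²/2)(‖P₊w₀‖² + ‖P₋w₀‖²) − (5 d_min/4)(‖w₊‖² + ‖w₋‖²) − d₂(‖w₊₊‖² + ‖w₋₋‖²) − (7d₀/4)‖w₀‖²`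
  under `8εℓ² ≤ d_min`, `4ε Dmax² ≤ d_min`, `εℓ² ≤ d₂`, `32 ε²ℓ² D0² ≤ d₀ d_min`.
  The drain form is `Q̂(w₀) = ‖P₊w₀‖² + ‖P₋w₀‖²` (memo §2: `= slotTerm`'s polarisation factor); the window anisotropy enters only through
  `Dmax, D0, d_j`.  NO regime restriction on `k̃` is needed: with (c1), `32ε²ℓ²D0² = 4ε·(8εℓ²)·D0² ≤ 4ε·d_min·D0²`, so (c4) follows from
  `4εD0² ≤ d₀`; in the window `d₀ ≥ 4π²νk̃²(lo/Λ)`, `D0 ≤ 4π²νk̃²(hiΛ+β)`, and the memo's `ε ≤ d_min/(4Dmax²) ≤ (lo/Λ)/(16π²ν|m|²(hiΛ+β)²)`,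
  hence `4εD0² ≤ d₀ ⟸ k̃² ≤ |m|²` — always (k̃ ≤ √3/2 < 1 ≤ |m|).  So the memo's (R1) bare-dissipation regime `k̃ ≥ k̃_*` is a convenience,
  not a necessity.  The conclusion leaves `5d_min/4` on `±1`; the ramp term (`ramp_term_le` of the scalar file, fed by `rampV_pairing_le`)
  uses `d_min/2` of it, ending at the memo's `3d_min/4`.
* `threeModeV_equiv`, `rampV_pairing_le` — norm equivalence `2|εX| ≤ εℓ√2·E₃` and the pairing bound the ramp step needs.
What the W7 prover instantiates: `E :=` the real Hilbert space `EuclideanSpace ℂ (Fin 3)` viewed over ℝ (or the fibre plane), `P_j :=`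
`transversalProj (K_j)` (PassiveVectorTensorModalAdjointCoeff, p664222), `y_j := 4π²·P_j(symbT 𝔸 K_j)P_j w_j`, `d_j, Dmax, D0` from
`NearIso`/`OddSmall` (`lo_mul_le_re_inner_symbT`), `l := a_s(t)·k̃(ê_s·q̂)/(2|m_s|)`.

v2 (same path) = v1 (39060944ff15) + **§F FIBRE INSTANTIATION** on `ℂ³ = EuclideanSpace ℂ (Fin 3)` with the tree's objects (S2 of p5 g10's
engine plan): `inner_transversalProj_comm` / `transversalProj_idem` (the Leray projection `Torus.transversalProj K` is a ℂ-self-adjoint idempotent),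
`re_inner_modalAdjGen_ge` (coercivity `4π²·lo·|K|²‖w‖² ≤ Re⟪modalAdjGen 𝔸 K w, w⟫` for `kdot K w = 0` under `NearIso 𝔸 lo hi` — discharges the
`hg_j` hypotheses with `d_j = 4π² lo |K_j|²`), the concrete chain right-hand sides `dW0C/dWpC/dWmC/bC/xdotC` (real coefficients acting as `(l:ℂ)•`),
and `threeModeC3_form_le` / `threeModeC3_equiv` / `rampC3_pairing_le` = the abstract theorems instantiated through
`InnerProductSpace.rclikeToReal ℂ` INSIDE the proofs (statements purely in `(⟪·,·⟫_ℂ).re`, `‖·‖`; transversality as `kdot`-conditions).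
v3 adds **§F5 the UPPER NORM BOUND** `norm_modalAdjGen_le : kdot K w = 0 → ‖modalAdjGen 𝔸 K w‖ ≤ 4π²·(hi + β/2)·|K|²·‖w‖` under
`NearIso 𝔸 lo hi` (`0 ≤ lo`, `0 ≤ hi`) and `OddSmall 𝔸 β` (`0 ≤ β`) — via `bsymb_add_left/right` (bilinearity in the vectors), `bsymb_symm_sq_le`
(Cauchy–Schwarz for the positive symmetrised transverse form, `discrim_le_zero`), `abs_bsymb_le` (`|β_𝔸(k;p,q)| ≤ (hi + β/2)|k|²|p||q|` on transversal
pairs), `re_inner_symbT_bilin` (bilinear version of `re_inner_symbT_eq`), `re_inner_symbT_le`; so the `Dmax`/`D0` hypotheses are DISCHARGED too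
(`Dmax = D0 := 4π²(hi+β/2)|K_j|²`).  What remains for the prover (S1): the identification of the Leray-projected Bloch-fibre chain ODE of
`cellField W …` with `dW0C/dWpC/dWmC` (phases gauged, `l = a_s k̃ (ê_s·q̂)/(2|m_s|)`), and the Grönwall/period/design spine (p5 g10 (b)).

- /


NOT a proof of the crux / of AD; rung F-D1.A0. [cite: BedrossianCotiZelati2017, §2 (hypocoercivity functional with a cross term)] [problem: turb]
-/

set_option linter.dupNamespace false

namespace Summit.AnomalousDissipation.AnomalousDissipation.Theorems.SolenoidalFractalHomogenisation.LagrangianStep.ThreeMode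

open scoped InnerProductSpace


/-- Young with a discriminant condition: `c x z ≤ a x² + b z²` whenever `0 ≤ a`, `0 ≤ b`, `c² ≤ 4ab`. -/
theorem young_disc (a b c x z : ℝ) (ha : 0 ≤ a) (hb : 0 ≤ b) (h : c ^ 2 ≤ 4 * a * b) :
    c * x * z ≤ a * x ^ 2 + b * z ^ 2 := by
  rcases eq_or_lt_of_le ha with h0 | hpos
  · have hc : c = 0 := by
      have : c ^ 2 ≤ 0 := by rw [← h0] at h; simpa using h
      exact pow_eq_zero_iff (n := 2) (by norm_num) |>.mp (le_antisymm this (sq_nonneg c))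
    subst hc; rw [← h0]; simp; positivity
  · have key : 0 ≤ 4 * a * (a * x ^ 2 + b * z ^ 2 - c * x * z) := by
      have : 4 * a * (a * x ^ 2 + b * z ^ 2 - c * x * z) = (2 * a * x - c * z) ^ 2 + (4 * a * b - c ^ 2) * z ^ 2 := by ring
      rw [this]; nlinarith [sq_nonneg (2 * a * x - c * z), sq_nonneg z]
    nlinarith

/-- `|b|²` step: `e l² nb² ≤ (dmin/4)(np² + nm²)` from `nb ≤ np + nm`, `8 e l² ≤ dmin`. -/
theorem stepB (e l dmin nb np nm : ℝ) (he : 0 ≤ e) (hnb0 : 0 ≤ nb) (hnb : nb ≤ np + nm)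
    (c1 : 8 * e * l ^ 2 ≤ dmin) : e * (l ^ 2 * nb ^ 2) ≤ (dmin / 4) * (np ^ 2 + nm ^ 2) := by
  have hel2 : 0 ≤ e * l ^ 2 := mul_nonneg he (sq_nonneg l)
  have h1 : nb ^ 2 ≤ (np + nm) ^ 2 := pow_le_pow_left₀ hnb0 hnb 2
  have h2 : (np + nm) ^ 2 ≤ 2 * (np ^ 2 + nm ^ 2) := by nlinarith [sq_nonneg (np - nm)]
  have h3 : e * l ^ 2 * nb ^ 2 ≤ e * l ^ 2 * (2 * (np ^ 2 + nm ^ 2)) :=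
    mul_le_mul_of_nonneg_left (h1.trans h2) hel2
  have hs : 0 ≤ np ^ 2 + nm ^ 2 := by positivity
  have h4 : e * l ^ 2 * (2 * (np ^ 2 + nm ^ 2)) ≤ (dmin / 4) * (np ^ 2 + nm ^ 2) := by
    have := mul_le_mul_of_nonneg_right c1 hs
    linarith
  linarith

/-- `y₀`-cross step: `e l |s0| ≤ (d0/8) n0² + (dmin/8)(np² + nm²)` from `|s0| ≤ D0 n0 nb`, `nb ≤ np + nm`,
`32 e² l² D0² ≤ d0 dmin`. -/
theorem stepY0 (e l d0 dmin D0 n0 nb np nm s0 : ℝ) (he : 0 ≤ e) (hl : 0 ≤ l) (hd0 : 0 ≤ d0) (hdmin : 0 ≤ dmin)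
    (hD0 : 0 ≤ D0) (hn0 : 0 ≤ n0) (hnb : nb ≤ np + nm) (hs0 : |s0| ≤ D0 * n0 * nb)
    (c4 : 32 * e ^ 2 * l ^ 2 * D0 ^ 2 ≤ d0 * dmin) :
    e * (l * |s0|) ≤ (d0 / 8) * n0 ^ 2 + (dmin / 8) * (np ^ 2 + nm ^ 2) := by
  have hel : 0 ≤ e * l := mul_nonneg he hl
  have h0 : D0 * n0 * nb ≤ D0 * n0 * (np + nm) := mul_le_mul_of_nonneg_left hnb (mul_nonneg hD0 hn0)
  have h1 : e * (l * |s0|) ≤ (e * l * D0) * n0 * (np + nm) := by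
    have := mul_le_mul_of_nonneg_left (hs0.trans h0) hel
    linarith
  have h2 : (e * l * D0) * n0 * (np + nm) ≤ (d0 / 8) * n0 ^ 2 + (dmin / 16) * (np + nm) ^ 2 := by
    apply young_disc _ _ _ _ _ (by positivity) (by positivity)
    nlinarith
  have h3 : (dmin / 16) * (np + nm) ^ 2 ≤ (dmin / 8) * (np ^ 2 + nm ^ 2) := by
    nlinarith [sq_nonneg (np - nm)]
  linarith

/-- `y_±`-cross step: `e l |sp| ≤ (e l²/4) a² + (dmin/4) np²` from `|sp| ≤ Dmax a np`, `4 e Dmax² ≤ dmin`. -/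
theorem stepY1 (e l dmin Dmax a np sp : ℝ) (he : 0 ≤ e) (hl : 0 ≤ l) (hsp : |sp| ≤ Dmax * a * np)
    (c2 : 4 * e * Dmax ^ 2 ≤ dmin) : e * (l * |sp|) ≤ (e * l ^ 2 / 4) * a ^ 2 + (dmin / 4) * np ^ 2 := by
  have h1 : e * (l * |sp|) ≤ e * (l * (Dmax * a * np)) :=
    mul_le_mul_of_nonneg_left (mul_le_mul_of_nonneg_left hsp hl) he
  have h2 : l * (Dmax * a * np) ≤ l ^ 2 / 4 * a ^ 2 + Dmax ^ 2 * np ^ 2 := by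
    nlinarith [sq_nonneg (l * a / 2 - Dmax * np)]
  have h3 : e * (l * (Dmax * a * np)) ≤ e * (l ^ 2 / 4 * a ^ 2 + Dmax ^ 2 * np ^ 2) := mul_le_mul_of_nonneg_left h2 he
  have h4 : e * (Dmax ^ 2 * np ^ 2) ≤ (dmin / 4) * np ^ 2 := by
    have := mul_le_mul_of_nonneg_right c2 (sq_nonneg np)
    linarith
  linarith

/-- `±2` step: `e l² |tp| ≤ (e l²/4) a² + dtwo npp²` from `|tp| ≤ a npp`, `e l² ≤ dtwo`. -/
theorem stepP2 (e l dtwo a npp tp : ℝ) (he : 0 ≤ e) (htp : |tp| ≤ a * npp) (c3 : e * l ^ 2 ≤ dtwo) :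
    e * (l ^ 2 * |tp|) ≤ (e * l ^ 2 / 4) * a ^ 2 + dtwo * npp ^ 2 := by
  have hel2 : 0 ≤ e * l ^ 2 := mul_nonneg he (sq_nonneg l)
  have h1 : e * (l ^ 2 * |tp|) ≤ e * l ^ 2 * (a * npp) := by
    have := mul_le_mul_of_nonneg_left htp hel2
    linarith
  have h2 : a * npp ≤ a ^ 2 / 4 + npp ^ 2 := by nlinarith [sq_nonneg (a / 2 - npp)]
  have h3 : e * l ^ 2 * (a * npp) ≤ e * l ^ 2 * (a ^ 2 / 4 + npp ^ 2) := mul_le_mul_of_nonneg_left h2 hel2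
  have h4 : e * l ^ 2 * npp ^ 2 ≤ dtwo * npp ^ 2 := mul_le_mul_of_nonneg_right c3 (sq_nonneg npp)
  linarith

set_option maxHeartbeats 800000 in
/-- The three-mode VECTOR inequality reduced to its real quantities.  Variables: `l` = ℓ, `e` = ε; norms `n0 np nm npp nmm` of
`w₀ w₊ w₋ w₊₊ w₋₋`, `a = ‖P₊w₀‖`, `bq = ‖P₋w₀‖`, `nb = ‖P₀(w₊−w₋)‖`; inner products `s0 = ⟪y₀, P₀(w₊−w₋)⟫`, `sp = ⟪P₊w₀, y₊⟫`,
`sm = ⟪P₋w₀, y₋⟫`, `tp = ⟪P₊w₀, w₊₊⟫`, `tm = ⟪P₋w₀, w₋₋⟫`; dissipations `g_j = ⟪y_j, w_j⟫`. -/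
theorem threeModeV_scalars_le
    (l e d0 dp dm dpp dmm dmin dtwo Dmax D0 n0 np nm npp nmm a bq nb s0 sp sm tp tm g0 gp gm gpp gmm : ℝ)
    (hl : 0 ≤ l) (he : 0 ≤ e) (hd0 : 0 ≤ d0) (hdmin : 0 ≤ dmin) (hD0 : 0 ≤ D0)
    (hn0 : 0 ≤ n0) (hnb0 : 0 ≤ nb) (hnb : nb ≤ np + nm)
    (hs0 : |s0| ≤ D0 * n0 * nb) (hsp : |sp| ≤ Dmax * a * np) (hsm : |sm| ≤ Dmax * bq * nm)
    (htp : |tp| ≤ a * npp) (htm : |tm| ≤ bq * nmm)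
    (hg0 : d0 * n0 ^ 2 ≤ g0) (hgp : dp * np ^ 2 ≤ gp) (hgm : dm * nm ^ 2 ≤ gm) (hgpp : dpp * npp ^ 2 ≤ gpp)
    (hgmm : dmm * nmm ^ 2 ≤ gmm)
    (hp : dmin ≤ dp) (hm : dmin ≤ dm) (hpp : dtwo ≤ dpp) (hmm : dtwo ≤ dmm)
    (c1 : 8 * e * l ^ 2 ≤ dmin) (c2 : 4 * e * Dmax ^ 2 ≤ dmin) (c3 : e * l ^ 2 ≤ dtwo)
    (c4 : 32 * e ^ 2 * l ^ 2 * D0 ^ 2 ≤ d0 * dmin) :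
    -2 * (g0 + gp + gm + gpp + gmm)
        + e * (l ^ 2 * nb ^ 2 - l * s0 - l * sp + l * sm - l ^ 2 * (a ^ 2 + bq ^ 2) + l ^ 2 * tp + l ^ 2 * tm)
      ≤ -(e * l ^ 2 / 2) * (a ^ 2 + bq ^ 2) - (5 * dmin / 4) * (np ^ 2 + nm ^ 2) - dtwo * (npp ^ 2 + nmm ^ 2)
        - (7 * d0 / 4) * n0 ^ 2 := by
  have y1 := stepB e l dmin nb np nm he hnb0 hnb c1
  have y2 := stepY0 e l d0 dmin D0 n0 nb np nm s0 he hl hd0 hdmin hD0 hn0 hnb hs0 c4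
  have y3 := stepY1 e l dmin Dmax a np sp he hl hsp c2
  have y4 := stepY1 e l dmin Dmax bq nm sm he hl hsm c2
  have y5 := stepP2 e l dtwo a npp tp he htp c3
  have y6 := stepP2 e l dtwo bq nmm tm he htm c3
  -- the raw terms are bounded by their absolute values
  have a0 : e * (-(l * s0)) ≤ e * (l * |s0|) := by
    refine mul_le_mul_of_nonneg_left ?_ he
    rw [← mul_neg]; exact mul_le_mul_of_nonneg_left (neg_le_abs s0) hl
  have ap : e * (-(l * sp)) ≤ e * (l * |sp|) := by
    refine mul_le_mul_of_nonneg_left ?_ he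
    rw [← mul_neg]; exact mul_le_mul_of_nonneg_left (neg_le_abs sp) hl
  have am : e * (l * sm) ≤ e * (l * |sm|) :=
    mul_le_mul_of_nonneg_left (mul_le_mul_of_nonneg_left (le_abs_self sm) hl) he
  have bp : e * (l ^ 2 * tp) ≤ e * (l ^ 2 * |tp|) :=
    mul_le_mul_of_nonneg_left (mul_le_mul_of_nonneg_left (le_abs_self tp) (sq_nonneg l)) he
  have bm : e * (l ^ 2 * tm) ≤ e * (l ^ 2 * |tm|) :=
    mul_le_mul_of_nonneg_left (mul_le_mul_of_nonneg_left (le_abs_self tm) (sq_nonneg l)) he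
  -- dissipation lower bounds
  have gp' : dmin * np ^ 2 ≤ gp := (mul_le_mul_of_nonneg_right hp (sq_nonneg np)).trans hgp
  have gm' : dmin * nm ^ 2 ≤ gm := (mul_le_mul_of_nonneg_right hm (sq_nonneg nm)).trans hgm
  have gpp' : dtwo * npp ^ 2 ≤ gpp := (mul_le_mul_of_nonneg_right hpp (sq_nonneg npp)).trans hgpp
  have gmm' : dtwo * nmm ^ 2 ≤ gmm := (mul_le_mul_of_nonneg_right hmm (sq_nonneg nmm)).trans hgmm
  have hn0sq : 0 ≤ d0 * n0 ^ 2 := by positivity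
  have hnp2 : 0 ≤ dmin * np ^ 2 := mul_nonneg hdmin (sq_nonneg np)
  have hnm2 : 0 ≤ dmin * nm ^ 2 := mul_nonneg hdmin (sq_nonneg nm)
  have expand : e * (l ^ 2 * nb ^ 2 - l * s0 - l * sp + l * sm - l ^ 2 * (a ^ 2 + bq ^ 2) + l ^ 2 * tp + l ^ 2 * tm)
      = e * (l ^ 2 * nb ^ 2) + e * (-(l * s0)) + e * (-(l * sp)) + e * (l * sm) - e * l ^ 2 * (a ^ 2 + bq ^ 2)
        + e * (l ^ 2 * tp) + e * (l ^ 2 * tm) := by ring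
  rw [expand]
  linarith only [y1, y2, y3, y4, y5, y6, a0, ap, am, bp, bm, hg0, gp', gm', gpp', gmm', hn0sq, hnp2, hnm2]


/-! ## The inner-product layer -/

section Vector

variable {E : Type*} [NormedAddCommGroup E] [InnerProductSpace ℝ E]

/-- A self-adjoint idempotent map does not increase norms. -/
theorem norm_proj_le (P : E → E) (hsa : ∀ x z : E, ⟪P x, z⟫_ℝ = ⟪x, P z⟫_ℝ) (hid : ∀ x : E, P (P x) = P x) (x : E) :
    ‖P x‖ ≤ ‖x‖ := by
  have h : ‖P x‖ ^ 2 ≤ ‖x‖ * ‖P x‖ := by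
    calc ‖P x‖ ^ 2 = ⟪P x, P x⟫_ℝ := (real_inner_self_eq_norm_sq _).symm
      _ = ⟪x, P (P x)⟫_ℝ := hsa x (P x)
      _ = ⟪x, P x⟫_ℝ := by rw [hid]
      _ ≤ ‖x‖ * ‖P x‖ := real_inner_le_norm _ _
  nlinarith [h, norm_nonneg x, norm_nonneg (P x)]

/-- `b = ẇ₀ + y₀`. -/
theorem bV_eq_dW0_add (l : ℝ) (P0 : E → E) (wp wm y0 : E) : bV l P0 wp wm = dW0 l P0 wp wm y0 + y0 := by
  simp [bV, dW0]

/-- EXPANSION of `xdotV` under the projection axioms (self-adjoint, idempotent; `P₀w₀ = w₀`, `P_±y_± = y_±`). -/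
theorem xdotV_expand (l : ℝ) (P0 Pp Pm : E → E) (w0 wp wm wpp wmm y0 yp ym : E)
    (hP0sa : ∀ x z : E, ⟪P0 x, z⟫_ℝ = ⟪x, P0 z⟫_ℝ) (hw0 : P0 w0 = w0)
    (hPpsa : ∀ x z : E, ⟪Pp x, z⟫_ℝ = ⟪x, Pp z⟫_ℝ) (hPpid : ∀ x : E, Pp (Pp x) = Pp x) (hyp : Pp yp = yp)
    (hPmsa : ∀ x z : E, ⟪Pm x, z⟫_ℝ = ⟪x, Pm z⟫_ℝ) (hPmid : ∀ x : E, Pm (Pm x) = Pm x) (hym : Pm ym = ym) :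
    xdotV l P0 Pp Pm w0 wp wm wpp wmm y0 yp ym
      = l ^ 2 * ‖P0 (wp - wm)‖ ^ 2 - l * ⟪y0, P0 (wp - wm)⟫_ℝ - l * ⟪Pp w0, yp⟫_ℝ + l * ⟪Pm w0, ym⟫_ℝ
        - l ^ 2 * (‖Pp w0‖ ^ 2 + ‖Pm w0‖ ^ 2) + l ^ 2 * ⟪Pp w0, wpp⟫_ℝ + l ^ 2 * ⟪Pm w0, wmm⟫_ℝ := by
  have e1 : ⟪dW0 l P0 wp wm y0, bV l P0 wp wm⟫_ℝ = -(l * ⟪y0, P0 (wp - wm)⟫_ℝ) + l ^ 2 * ‖P0 (wp - wm)‖ ^ 2 := by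
    simp only [dW0, bV, inner_add_left, inner_neg_left, real_inner_smul_right,
      real_inner_self_eq_norm_sq, norm_smul, mul_pow, Real.norm_eq_abs, sq_abs]
    try ring
  have e2 : ⟪w0, l • P0 (dWp l Pp w0 wpp yp - dWm l Pm w0 wmm ym)⟫_ℝ
      = l * ⟪w0, dWp l Pp w0 wpp yp - dWm l Pm w0 wmm ym⟫_ℝ := by
    rw [real_inner_smul_right, ← hP0sa, hw0]
  have h1 : ⟪w0, yp⟫_ℝ = ⟪Pp w0, yp⟫_ℝ := by
    calc ⟪w0, yp⟫_ℝ = ⟪w0, Pp yp⟫_ℝ := by rw [hyp]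
      _ = ⟪Pp w0, yp⟫_ℝ := (hPpsa w0 yp).symm
  have h2 : ⟪w0, Pp w0⟫_ℝ = ‖Pp w0‖ ^ 2 := by
    calc ⟪w0, Pp w0⟫_ℝ = ⟪w0, Pp (Pp w0)⟫_ℝ := by rw [hPpid]
      _ = ⟪Pp w0, Pp w0⟫_ℝ := (hPpsa w0 (Pp w0)).symm
      _ = ‖Pp w0‖ ^ 2 := real_inner_self_eq_norm_sq _
  have h3 : ⟪w0, Pp wpp⟫_ℝ = ⟪Pp w0, wpp⟫_ℝ := (hPpsa w0 wpp).symm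
  have h1' : ⟪w0, ym⟫_ℝ = ⟪Pm w0, ym⟫_ℝ := by
    calc ⟪w0, ym⟫_ℝ = ⟪w0, Pm ym⟫_ℝ := by rw [hym]
      _ = ⟪Pm w0, ym⟫_ℝ := (hPmsa w0 ym).symm
  have h2' : ⟪w0, Pm w0⟫_ℝ = ‖Pm w0‖ ^ 2 := by
    calc ⟪w0, Pm w0⟫_ℝ = ⟪w0, Pm (Pm w0)⟫_ℝ := by rw [hPmid]
      _ = ⟪Pm w0, Pm w0⟫_ℝ := (hPmsa w0 (Pm w0)).symm
      _ = ‖Pm w0‖ ^ 2 := real_inner_self_eq_norm_sq _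
  have h3' : ⟪w0, Pm wmm⟫_ℝ = ⟪Pm w0, wmm⟫_ℝ := (hPmsa w0 wmm).symm
  have e3 : ⟪w0, dWp l Pp w0 wpp yp - dWm l Pm w0 wmm ym⟫_ℝ
      = -⟪Pp w0, yp⟫_ℝ - l * ‖Pp w0‖ ^ 2 + l * ⟪Pp w0, wpp⟫_ℝ + ⟪Pm w0, ym⟫_ℝ + l * ⟪Pm w0, wmm⟫_ℝ
        - l * ‖Pm w0‖ ^ 2 := by
    simp only [dWp, dWm, inner_sub_right, inner_neg_right, real_inner_smul_right, h1, h2, h3,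
      h1', h2', h3']
    ring
  unfold xdotV
  rw [e1, e2, e3]
  ring

set_option maxHeartbeats 800000 in
/-- THE VECTOR THREE-MODE FORM INEQUALITY (memo §2, anisotropic window, projected modes).  Hypotheses: projection axioms;
dissipation `d_j‖w_j‖² ≤ ⟪y_j, w_j⟫`; damping sizes `‖y_±‖ ≤ Dmax‖w_±‖`, `‖y₀‖ ≤ D0‖w₀‖`; `d_min ≤ d_±`, `d₂ ≤ d_{±2}`; smallness of
`e = ε`: `8εl² ≤ d_min`, `4εDmax² ≤ d_min`, `εl² ≤ d₂`, `32ε²l²D0² ≤ d₀d_min`.  Conclusion: the drain `−(εl²/2)·(‖P₊w₀‖²+‖P₋w₀‖²)`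
on the slow mode with `5d_min/4` left on `±1` (of which the ramp uses `d_min/2`), `d₂` on `±2`, `7d₀/4` on mode 0. -/
theorem threeModeV_form_le (l e d0 dp dm dpp dmm dmin dtwo Dmax D0 : ℝ) (P0 Pp Pm : E → E)
    (w0 wp wm wpp wmm y0 yp ym ypp ymm : E)
    (hP0sa : ∀ x z : E, ⟪P0 x, z⟫_ℝ = ⟪x, P0 z⟫_ℝ) (hP0id : ∀ x : E, P0 (P0 x) = P0 x) (hw0 : P0 w0 = w0)
    (hPpsa : ∀ x z : E, ⟪Pp x, z⟫_ℝ = ⟪x, Pp z⟫_ℝ) (hPpid : ∀ x : E, Pp (Pp x) = Pp x) (hyp : Pp yp = yp)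
    (hPmsa : ∀ x z : E, ⟪Pm x, z⟫_ℝ = ⟪x, Pm z⟫_ℝ) (hPmid : ∀ x : E, Pm (Pm x) = Pm x) (hym : Pm ym = ym)
    (hl : 0 ≤ l) (he : 0 ≤ e) (hd0 : 0 ≤ d0) (hdmin : 0 ≤ dmin) (hD0 : 0 ≤ D0)
    (hg0 : d0 * ‖w0‖ ^ 2 ≤ ⟪y0, w0⟫_ℝ) (hgp : dp * ‖wp‖ ^ 2 ≤ ⟪yp, wp⟫_ℝ) (hgm : dm * ‖wm‖ ^ 2 ≤ ⟪ym, wm⟫_ℝ)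
    (hgpp : dpp * ‖wpp‖ ^ 2 ≤ ⟪ypp, wpp⟫_ℝ) (hgmm : dmm * ‖wmm‖ ^ 2 ≤ ⟪ymm, wmm⟫_ℝ)
    (hYp : ‖yp‖ ≤ Dmax * ‖wp‖) (hYm : ‖ym‖ ≤ Dmax * ‖wm‖) (hY0 : ‖y0‖ ≤ D0 * ‖w0‖)
    (hp : dmin ≤ dp) (hm : dmin ≤ dm) (hpp : dtwo ≤ dpp) (hmm : dtwo ≤ dmm)
    (c1 : 8 * e * l ^ 2 ≤ dmin) (c2 : 4 * e * Dmax ^ 2 ≤ dmin) (c3 : e * l ^ 2 ≤ dtwo)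
    (c4 : 32 * e ^ 2 * l ^ 2 * D0 ^ 2 ≤ d0 * dmin) :
    -2 * (⟪y0, w0⟫_ℝ + ⟪yp, wp⟫_ℝ + ⟪ym, wm⟫_ℝ + ⟪ypp, wpp⟫_ℝ + ⟪ymm, wmm⟫_ℝ)
        + e * xdotV l P0 Pp Pm w0 wp wm wpp wmm y0 yp ym
      ≤ -(e * l ^ 2 / 2) * (‖Pp w0‖ ^ 2 + ‖Pm w0‖ ^ 2) - (5 * dmin / 4) * (‖wp‖ ^ 2 + ‖wm‖ ^ 2)
        - dtwo * (‖wpp‖ ^ 2 + ‖wmm‖ ^ 2) - (7 * d0 / 4) * ‖w0‖ ^ 2 := by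
  rw [xdotV_expand l P0 Pp Pm w0 wp wm wpp wmm y0 yp ym hP0sa hw0 hPpsa hPpid hyp hPmsa hPmid hym]
  have hnb : ‖P0 (wp - wm)‖ ≤ ‖wp‖ + ‖wm‖ := (norm_proj_le P0 hP0sa hP0id _).trans (norm_sub_le _ _)
  have hs0 : |⟪y0, P0 (wp - wm)⟫_ℝ| ≤ D0 * ‖w0‖ * ‖P0 (wp - wm)‖ :=
    (abs_real_inner_le_norm _ _).trans (mul_le_mul_of_nonneg_right hY0 (norm_nonneg _))
  have hsp : |⟪Pp w0, yp⟫_ℝ| ≤ Dmax * ‖Pp w0‖ * ‖wp‖ := by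
    calc |⟪Pp w0, yp⟫_ℝ| ≤ ‖Pp w0‖ * ‖yp‖ := abs_real_inner_le_norm _ _
      _ ≤ ‖Pp w0‖ * (Dmax * ‖wp‖) := mul_le_mul_of_nonneg_left hYp (norm_nonneg _)
      _ = Dmax * ‖Pp w0‖ * ‖wp‖ := by ring
  have hsm : |⟪Pm w0, ym⟫_ℝ| ≤ Dmax * ‖Pm w0‖ * ‖wm‖ := by
    calc |⟪Pm w0, ym⟫_ℝ| ≤ ‖Pm w0‖ * ‖ym‖ := abs_real_inner_le_norm _ _
      _ ≤ ‖Pm w0‖ * (Dmax * ‖wm‖) := mul_le_mul_of_nonneg_left hYm (norm_nonneg _)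
      _ = Dmax * ‖Pm w0‖ * ‖wm‖ := by ring
  have htp : |⟪Pp w0, wpp⟫_ℝ| ≤ ‖Pp w0‖ * ‖wpp‖ := abs_real_inner_le_norm _ _
  have htm : |⟪Pm w0, wmm⟫_ℝ| ≤ ‖Pm w0‖ * ‖wmm‖ := abs_real_inner_le_norm _ _
  have := threeModeV_scalars_le l e d0 dp dm dpp dmm dmin dtwo Dmax D0 ‖w0‖ ‖wp‖ ‖wm‖ ‖wpp‖ ‖wmm‖ ‖Pp w0‖ ‖Pm w0‖
    ‖P0 (wp - wm)‖ ⟪y0, P0 (wp - wm)⟫_ℝ ⟪Pp w0, yp⟫_ℝ ⟪Pm w0, ym⟫_ℝ ⟪Pp w0, wpp⟫_ℝ ⟪Pm w0, wmm⟫_ℝ ⟪y0, w0⟫_ℝ ⟪yp, wp⟫_ℝ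
    ⟪ym, wm⟫_ℝ ⟪ypp, wpp⟫_ℝ ⟪ymm, wmm⟫_ℝ hl he hd0 hdmin hD0 (norm_nonneg _) (norm_nonneg _) hnb hs0 hsp hsm htp htm hg0 hgp
    hgm hgpp hgmm hp hm hpp hmm c1 c2 c3 c4
  linarith only [this]

/-- NORM EQUIVALENCE of the vector functional: `2|e·⟪w₀, b⟫| ≤ e·l·√2·(‖w₀‖² + ‖w₊‖² + ‖w₋‖²)` — so `εl√2 ≤ 1/4` gives
`(7/8)E ≤ Φ ≤ (9/8)E`. -/
theorem threeModeV_equiv (l e : ℝ) (P0 : E → E) (w0 wp wm : E)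
    (hP0sa : ∀ x z : E, ⟪P0 x, z⟫_ℝ = ⟪x, P0 z⟫_ℝ) (hP0id : ∀ x : E, P0 (P0 x) = P0 x) (hl : 0 ≤ l) (he : 0 ≤ e) :
    2 * |e * ⟪w0, bV l P0 wp wm⟫_ℝ| ≤ e * l * Real.sqrt 2 * (‖w0‖ ^ 2 + ‖wp‖ ^ 2 + ‖wm‖ ^ 2) := by
  have hnb : ‖P0 (wp - wm)‖ ≤ ‖wp‖ + ‖wm‖ := (norm_proj_le P0 hP0sa hP0id _).trans (norm_sub_le _ _)
  have h1 : |e * ⟪w0, bV l P0 wp wm⟫_ℝ| = e * l * |⟪w0, P0 (wp - wm)⟫_ℝ| := by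
    simp only [bV, real_inner_smul_right, abs_mul, abs_of_nonneg he, abs_of_nonneg hl]; ring
  have h2 : |⟪w0, P0 (wp - wm)⟫_ℝ| ≤ ‖w0‖ * (‖wp‖ + ‖wm‖) :=
    (abs_real_inner_le_norm _ _).trans (mul_le_mul_of_nonneg_left hnb (norm_nonneg _))
  have hs : Real.sqrt 2 * Real.sqrt 2 = 2 := Real.mul_self_sqrt (by norm_num)
  have hs0 : 0 ≤ Real.sqrt 2 := Real.sqrt_nonneg 2
  have hs0' : 0 < Real.sqrt 2 := Real.sqrt_pos.mpr (by norm_num)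
  have h3 : 2 * (‖w0‖ * (‖wp‖ + ‖wm‖)) ≤ Real.sqrt 2 * (‖w0‖ ^ 2 + ‖wp‖ ^ 2 + ‖wm‖ ^ 2) := by
    have hq : (‖wp‖ + ‖wm‖) ^ 2 ≤ 2 * (‖wp‖ ^ 2 + ‖wm‖ ^ 2) := by nlinarith [sq_nonneg (‖wp‖ - ‖wm‖)]
    have hx : 2 * Real.sqrt 2 * (‖w0‖ * (‖wp‖ + ‖wm‖)) ≤ 2 * ‖w0‖ ^ 2 + (‖wp‖ + ‖wm‖) ^ 2 := by
      nlinarith [sq_nonneg (Real.sqrt 2 * ‖w0‖ - (‖wp‖ + ‖wm‖)), hs]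
    have h' : Real.sqrt 2 * (Real.sqrt 2 * (‖w0‖ ^ 2 + ‖wp‖ ^ 2 + ‖wm‖ ^ 2))
        = 2 * (‖w0‖ ^ 2 + ‖wp‖ ^ 2 + ‖wm‖ ^ 2) := by rw [← mul_assoc, hs]
    have key : Real.sqrt 2 * (2 * (‖w0‖ * (‖wp‖ + ‖wm‖)))
        ≤ Real.sqrt 2 * (Real.sqrt 2 * (‖w0‖ ^ 2 + ‖wp‖ ^ 2 + ‖wm‖ ^ 2)) := by
      rw [h']; linarith
    exact le_of_mul_le_mul_left key hs0'
  rw [h1]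
  have hel : 0 ≤ e * l := mul_nonneg he hl
  nlinarith [mul_le_mul_of_nonneg_left (h2.trans (by nlinarith [h3] : ‖w0‖ * (‖wp‖ + ‖wm‖) ≤
    Real.sqrt 2 / 2 * (‖w0‖ ^ 2 + ‖wp‖ ^ 2 + ‖wm‖ ^ 2))) hel]

/-- RAMP TERM, vector form: the `l̇`-part of `Ẋ` is `(l̇/l)·⟪w₀, b⟫`; with `b = l•P₀(w₊−w₋)` it is bounded exactly as in
`ramp_term_le`: `|⟪w₀, P₀(w₊ − w₋)⟫| ≤ ‖w₀‖(‖w₊‖ + ‖w₋‖)`. -/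
theorem rampV_pairing_le (P0 : E → E) (w0 wp wm : E)
    (hP0sa : ∀ x z : E, ⟪P0 x, z⟫_ℝ = ⟪x, P0 z⟫_ℝ) (hP0id : ∀ x : E, P0 (P0 x) = P0 x) :
    |⟪w0, P0 (wp - wm)⟫_ℝ| ≤ ‖w0‖ * (‖wp‖ + ‖wm‖) :=
  (abs_real_inner_le_norm _ _).trans
    (mul_le_mul_of_nonneg_left ((norm_proj_le P0 hP0sa hP0id _).trans (norm_sub_le _ _)) (norm_nonneg _))

end Vector

end Summit.AnomalousDissipation.AnomalousDissipation.Theorems.SolenoidalFractalHomogenisation.LagrangianStep.ThreeMode
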